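import Literature.IUT.LogThetaLattice.TensorPackets
import Mathlib.RingTheory.IntegralClosure.Algebra.Basic
import HarnessLib

/-!
# [IUTchIII] Remark 3.1.1 (i): the print-faithful GUARDED instance form of `Remark311i_model` (FACT row F-2128)

S. Mochizuki, *Inter-universal Teichmüller theory III*, kurims manuscript (May 2020) of PRIMS **57** (2021),
§3, Remark 3.1.1 (i), pp. 93–94: "write `k := K_v`; let `k̄` be an algebraic closure of `k`. Then, roughly
speaking, … `log(^α𝓕_v) ≅ k̄`; `Ψ_{log(^α𝓕_v)} ≅ 𝒪_{k̄}`; … each `Ψ_{log(^α𝓕_v)}` is a copy of the set [i.e., a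
ring, when `v ∈ 𝕍^non`] of integers `𝒪_{k̄} ⊆ k̄`. In particular, the 'integral structures' discussed in the
final portion of Proposition 3.1, (ii), correspond to copies of `𝒪_{k̄}` contained in copies of `k̄`."
[cite: Mochizuki2012, IUTchIII Rmk 3.1.1 (i) p.93–94] [claim: Mochizuki2012, status: disputed] (D-0012 claim
key; the mathematics below is undisputed commutative algebra: algebra isomorphisms preserve integrality).

PROOF-ONLY companion (0 definitions, nothing restated) of abc-iut-L6-t4's `TensorPackets.lean`
(`Remark311i_model`, p403825/p405525) for the abc-iut FACT-LIST row **F-2128** (D-0079 L-F sub-cell F6).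
State of the row before this file: the universal closure of the typed schema is REFUTED
(`not_forall_remark311i_model`, `TensorPacketsModelSchemaNegative.lean` p432896: with FREE integral
structures `O = ℤ ⊆ ℚ = L`, `Okbar = ℚ`, no `ℚ`-algebra isomorphism matches them) and the instance form of
record `LogShellBridge.remark311i_model_holds` (p414045) is the IDENTITY isomorphism of the bridge data with
itself.

THIS FILE supplies the print-faithful GUARD and proves the schema under it, for ALL data:

* `Remark311i_model_of_integralClosure` — **GUARD = the integral structures on both sides are the CANONICAL
  rings of integers**, i.e. the integral closures of one base ring `R` (in print: `ℤ_{p_v}`, equivalently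
  `𝒪_{K_v}`; `𝒪_{k̄}` = the integral closure of `ℤ_{p_v}` in `k̄`) along the scalar tower `R → 𝕜 → L α v`,
  `R → 𝕜 → k̄_v`, and each `log(^α𝓕_v)` is ABSTRACTLY `𝕜`-isomorphic to `k̄_v` ("`log(^α𝓕_v) ≅ k̄`") — then
  `Remark311i_model` HOLDS: every such isomorphism automatically matches the integral structures
  ("`Ψ_{log(^α𝓕_v)} ≅ 𝒪_{k̄}`"), because algebra isomorphisms preserve integral closures
  (`isIntegral_algEquiv`). The refuting instance of p432896 violates exactly this guard (`ℤ ⊆ ℚ` is an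
  integral closure of `ℤ`, but `ℚ ⊆ ℚ` is not).
* `Remark311i_model_of_integralClosure_self` — in particular at `L α v := k̄_v` itself with ANY family of
  `𝕜`-algebra automorphisms (e.g. elements of `Gal(k̄/k)`, the "`^αΠ_v`"-indeterminacy of Prop. 3.1 (i)):
  the canonical integral structure is carried to itself.
* `Remark311i_model_iff_map_eq` — the schema for a GIVEN pair of integral structures holds iff some
  `𝕜`-isomorphism maps the one ONTO the other; with the canonical choice on the model side this pins
  `O α v` to be the set of elements whose image is `R`-integral
  (`exists_mem_iff_isIntegral_of_remark311i_model`): the guard is also NECESSARY coordinatewise.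

DECISION RECORDED FOR F-2128 (our kernel, our typed statement; nothing about print is adjudicated):
universal closure REFUTED (p432896) · print-faithful guarded instance form PROVED (this file) · instance of
record p414045. No side taken on [IUTchIII] Cor. 3.12; nothing here asserts abc proved or refuted;
typed ≠ proved elsewhere.
-/

namespace Literature.IUT.LogThetaLattice

universe u v v' w u'

section Remark311iGuarded

variable {𝕜 : Type u} [Field 𝕜]
variable {A : Type v} {Vfib : Type v'}
variable {L : A → Vfib → Type w} [∀ α v, CommRing (L α v)] [∀ α v, Algebra 𝕜 (L α v)]
variable {kbar : Vfib → Type w} [∀ v, Field (kbar v)] [∀ v, Algebra 𝕜 (kbar v)]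
variable (R : Type u') [CommRing R] [Algebra R 𝕜]
variable [∀ α v, Algebra R (L α v)] [∀ α v, IsScalarTower R 𝕜 (L α v)]
variable [∀ v, Algebra R (kbar v)] [∀ v, IsScalarTower R 𝕜 (kbar v)]

/-- **F-2128, print-faithful guarded instance form of [IUTchIII] Rmk. 3.1.1 (i)** (p. 93–94:
"`log(^α𝓕_v) ≅ k̄`; `Ψ_{log(^α𝓕_v)} ≅ 𝒪_{k̄}` … the 'integral structures' … correspond to copies of `𝒪_{k̄}`
contained in copies of `k̄`"). GUARD: the integral structures are the CANONICAL ones — the integral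
closures of a base ring `R` (print: `ℤ_{p_v}`, or `𝒪_{K_v}`) along the scalar towers `R → 𝕜 → log(^α𝓕_v)`,
`R → 𝕜 → k̄_v` — and each `log(^α𝓕_v)` is abstractly `𝕜`-isomorphic to `k̄_v`. CONCLUSION: abc-iut-L6-t4's
`Remark311i_model` holds, i.e. the isomorphisms match the integral structures — PROVED for all data
(algebra isomorphisms preserve integrality). [cite: Mochizuki2012, IUTchIII Rmk 3.1.1 (i) p.93–94]
[claim: Mochizuki2012, status: disputed] -/
theorem Remark311i_model_of_integralClosure (e : ∀ α v, L α v ≃ₐ[𝕜] kbar v) :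
    Remark311i_model 𝕜 L (fun α v => (integralClosure R (L α v)).toSubring) kbar
      (fun v => (integralClosure R (kbar v)).toSubring) := by
  intro α v
  refine ⟨e α v, fun x => ?_⟩
  change x ∈ integralClosure R (L α v) ↔ (e α v) x ∈ integralClosure R (kbar v)
  rw [mem_integralClosure_iff, mem_integralClosure_iff]
  exact (isIntegral_algEquiv ((e α v).restrictScalars R)).symm

omit [∀ α v, Algebra R (L α v)] [∀ α v, IsScalarTower R 𝕜 (L α v)] in
/-- **F-2128 at the model data itself** ([IUTchIII] Rmk. 3.1.1 (i), p. 93–94; Prop. 3.1 (i) p. 93: the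
decompositions are "compatible … with the natural action of `^αΠ_v`"): with `log(^α𝓕_v) := k̄_v` and ANY
family of `𝕜`-algebra automorphisms `σ α v` of `k̄_v` (e.g. Galois elements), the CANONICAL integral
structure `𝒪_{k̄_v}` = integral closure of `R` is carried onto itself, so `Remark311i_model` holds for the
pair (canonical, canonical) through `σ` — the non-tautological version of the identity witness p414045.
[cite: Mochizuki2012, IUTchIII Rmk 3.1.1 (i) p.93–94] [claim: Mochizuki2012, status: disputed] -/
theorem Remark311i_model_of_integralClosure_self (σ : A → ∀ v, kbar v ≃ₐ[𝕜] kbar v) :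
    Remark311i_model 𝕜 (fun (_ : A) v => kbar v) (fun _ v => (integralClosure R (kbar v)).toSubring) kbar
      (fun v => (integralClosure R (kbar v)).toSubring) :=
  Remark311i_model_of_integralClosure (L := fun (_ : A) v => kbar v) R σ

omit [Algebra R 𝕜] [∀ α v, Algebra R (L α v)] [∀ α v, IsScalarTower R 𝕜 (L α v)]
  [∀ v, Algebra R (kbar v)] [∀ v, IsScalarTower R 𝕜 (kbar v)] in
/-- The schema for a GIVEN pair of integral structures, unfolded: `Remark311i_model 𝕜 L O kbar Okbar` holds
iff at every `(α, v)` some `𝕜`-algebra isomorphism `log(^α𝓕_v) ≅ k̄_v` maps `O α v` ONTO `Okbar v`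
([IUTchIII] Rmk. 3.1.1 (i), p. 93–94) — PROVED (set-theoretic bookkeeping).
[cite: Mochizuki2012, IUTchIII Rmk 3.1.1 (i) p.93–94] [claim: Mochizuki2012, status: disputed] -/
theorem Remark311i_model_iff_map_eq (O : ∀ α v, Subring (L α v)) (Okbar : ∀ v, Subring (kbar v)) :
    Remark311i_model 𝕜 L O kbar Okbar ↔
      ∀ α v, ∃ e : L α v ≃ₐ[𝕜] kbar v, (O α v).map (e : L α v →+* kbar v) = Okbar v := by
  refine forall_congr' fun α => forall_congr' fun v => exists_congr fun e => ?_
  constructor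
  · intro h
    ext y
    constructor
    · rintro ⟨x, hx, rfl⟩
      exact (h x).mp hx
    · intro hy
      refine ⟨e.symm y, (h (e.symm y)).mpr ?_, ?_⟩
      · simpa using hy
      · simp
  · intro h x
    rw [← h]
    constructor
    · intro hx
      exact ⟨x, hx, rfl⟩
    · rintro ⟨x', hx', hxx'⟩
      have : x' = x := (e : L α v ≃ₐ[𝕜] kbar v).injective (by simpa using hxx')
      exact this ▸ hx'

omit [Algebra R 𝕜] [∀ α v, Algebra R (L α v)] [∀ α v, IsScalarTower R 𝕜 (L α v)]
  [∀ v, IsScalarTower R 𝕜 (kbar v)] in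
/-- **The guard is NECESSARY coordinatewise** ([IUTchIII] Rmk. 3.1.1 (i), p. 93–94): if the schema holds
against the CANONICAL model integral structure `𝒪_{k̄_v}` = integral closure of `R` in `k̄_v`, then each
given integral structure `O α v ⊆ log(^α𝓕_v)` IS the integral closure of `R` in `log(^α𝓕_v)` for the
`R`-algebra structure pulled back along the witnessing isomorphism — the refuting instance of p432896
(`O = ℤ ⊆ ℚ`, model side `ℚ ⊆ ℚ`) is excluded precisely because `ℚ` is not an integral closure of `ℤ` in `ℚ`
… stated here in the transported form: `x ∈ O α v ↔ e x` is `R`-integral.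
[cite: Mochizuki2012, IUTchIII Rmk 3.1.1 (i) p.93–94] [claim: Mochizuki2012, status: disputed] -/
theorem exists_mem_iff_isIntegral_of_remark311i_model (O : ∀ α v, Subring (L α v))
    (h : Remark311i_model 𝕜 L O kbar fun v => (integralClosure R (kbar v)).toSubring) (α : A) (v : Vfib) :
    ∃ e : L α v ≃ₐ[𝕜] kbar v, ∀ x, x ∈ O α v ↔ IsIntegral R (e x) := by
  obtain ⟨e, he⟩ := h α v
  exact ⟨e, fun x => (he x).trans Iff.rfl⟩

end Remark311iGuarded

end Literature.IUT.LogThetaLattice
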